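import Summits.QuantumFields.YangMills.Theorems.BalabanUVNodesK0CompCofinalRadiiOfFixedRadius
import Summits.QuantumFields.YangMills.Theorems.BalabanUVNodesK0Beta13RadiusBlindGuarded
import Summits.QuantumFields.YangMills.Theorems.BalabanUVNodesK0TopSocketOfThm1EUText

/-!
# K0⁷ — THE ONE-RADIUS DOOR (κ_cof) WITH N07's SLOTS ASKED INSIDE A LEVEL GUARD ONLY, AND `hT1` THERE SUPPLIED BY THE TEXTS: g20's LOCATED «S1c level guard» obstruction
# between the K0∕N12 texts and the doors' slot `hT1` is VOID for β (β of record reads only the `K`-tail); at `N = 2` the slot `hT1` LEAVES THE BILL in favour of N12's EU-text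
# (the (8)-text being dag-n07-e's theorem) — the remaining [15]-side bill is `hUk ∕ h11 ∕ hLip` inside the guard (D-defB-1's two slots + Prop. 9's), nothing at the 48 coarsest levels

Cell `pub-ymgap`, width seat `pub-ymgap-dag-n07-w3` (g21; N07 [B11] ∕ K0⁷ junction).  `--kind proof --supports stmt-QuantumFields-20541 --as helper`, COUNT-NEUTRAL.  NEW leaf; theorems
only — 0 `def`, 0 `sorry`, 0 `instance`, 0 `notation`.  Imports this seat's g21 files `…K0CompCofinalRadiiOfFixedRadius` (✓p795400: door (κ_cof)'s `F`-clause from comparability at ONE radius)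
and `…K0Beta13RadiusBlindGuarded` (the read-set induction with a level guard; single-level rider ∕ collar), and g20's (T1) socket `…K0TopSocketOfThm1EUText` (✓p794145: `hT1` inside the guard
from the (8)-text + EU-text).  [I] = [Balaban1987RG1]; [15] = [Balaban1985Variational]; [III] = [Balaban1988Convergent]; [B7] = [Balaban1985Averaging].

CONTENT.
* §1 ★ `betaZB_eq_down_of_slots_guarded` — file ✓p795400 §1's downward β-identity `β₁₃(F; ā, ε₂₉) = β₁₃(F; a₀, ε₂₉)` (`ρ ≤ a₀ ≤ ā`) with the four slots `hT1 ∕ hUk ∕ h11 ∕ hLip` asked only at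
  members `(K, k)` with `G K k`, and the continuity row (hT) only at steps with `G K (k+1)`, for ANY guard `G` antitone in the level and eventually true in `K` at each level (read-set induction
  of `…RadiusBlindGuarded` on `Û K k := domUOfRecord ⟨…, ε₀ := δ₁₁⟩ ā ρ K k` in range; every slot consumer — openness with (I) derived, `1 ∈ Û`, the collar (single-level edition), nesting,
  selector agreement downward — reads the slots at its own member only).
* §2 ★★ `k0CompCofinalRadii_clause_of_compAtFixedRadius_guarded` — DEF-1's door (κ_cof), `F`-clause, from the ONE-RADIUS comparability letter (W₁ᶜ) along cofinal thresholds + the nine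
  door-level numerics + the GUARDED slots and continuity rows (per ceiling `a`: `a₀ := min a ā`, `ε₂₉ := min εmax (a₀∕c)`, `ρ := c·ε₂₉`, `c := 80B_L L⁴ + 1`, as in ✓p795400 §2).
* §3 ★★ `hT1_guarded_of_texts` — at `N = 2`... no: at every `N`, the slot `hT1` INSIDE the guard `k + max c₀ c₁ ≤ F.m + K` with constant `B := B₃ ≥ 7` and ceilings `(a₀, min a₁ (a₀∕B₃))` from the
  (8)-text `VariationalThm1RegSepCoP7MGB … B₃ a₀ a₁` and the EU-text `VariationalThm1EUSepCoP7MG … B₃ a₀ a₁` at the same guard letters (levels `k ≥ 1`: g20's `thm1Objects_of_texts`; level `0`: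
  the datum itself, dag-n21-c's argument at constant `B₃ ≥ 7`);  ★★★ `k0CompCofinalRadii_clause_of_texts_of_compAtFixedRadius` — §2 with `hT1` DISCHARGED by §3: door (κ_cof)'s `F`-clause
  from the two texts + `hUk ∕ h11 ∕ hLip` inside the guard + continuity rows + numerics + the one-radius comparability letter.  At `N = 2` the (8)-text at the S1c witness's letters is dag-n07-e's
  theorem (`K0Stub1BHolds` + 53′, g20 file 5 §7), so there the EU-text is the only Theorem-1 sentence left on the `hT1` line.
K0⁷ BY NAME: `K0V23Stub3DoorSuppliers.record13SepCoPHInhabited_of_k0CompCofinalRadii (fun F => k0CompCofinalRadii_clause_of_texts_of_compAtFixedRadius F …)` (Theses cone; one line; not typed here).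

HONEST FRAMING (binding).  By-name composition + real arithmetic; NO β estimate; nothing of Bałaban's asserted or discharged.  DISPLAYED and inhabited nowhere: the one-radius comparability
letter (NODE O's wall read along runs), the continuity rows (hT), the EU-text ([15] Thm 1 existence ∕ uniqueness over class (6), N12's sentence), `hUk` ∕ `h11` (₈a rows ∕ (1.1) in the
PLAQUETTE class — D-defB-1 stands: not implied by the texts), `hLip` ([15] Prop. 9 species).  Stub 2′ OPEN; K0⁷ stmt-QuantumFields-20541 NOT closed; N07 NOT discharged; COUNT 8∕28 · K 1∕4
UNMOVED; R4 = the CONDITIONAL finite-𝕋⁴ rung `BalabanLadder.UV` at fixed `ε = L^(−K)` only — NOT continuum ∕ ℝ⁴ ∕ OS; the Yang–Mills mass gap (Clay) is NOT proved by any of this.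
Standard axioms only.
-/

noncomputable section

open MeasureTheory Set Filter Topology
open scoped Matrix.Norms.L2Operator

namespace Summit.QuantumFields.YangMills.BalabanUVNodes.K0CompCofinalRadiiOfFixedRadiusGuarded

open Literature.MathematicalPhysics.QuantumFieldTheory.Balaban1983to89
open Literature.MathematicalPhysics.QuantumFieldTheory.Balaban1983to89.Node00
open Literature.MathematicalPhysics.QuantumFieldTheory.Balaban1983to89.T4Continuum
open Literature.MathematicalPhysics.QuantumFieldTheory.Balaban1983to89.FlowStep
open Literature.MathematicalPhysics.QuantumFieldTheory.Balaban1983to89.B15DeterminingSets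
open Literature.MathematicalPhysics.QuantumFieldTheory.Balaban1983to89.ExpMeanLog (deltaSU deltaSU_pos)
open Literature.MathematicalPhysics.QuantumFieldTheory.Balaban1983to89.B12GaugeOrbits021 (OrbitRel)
open Literature.MathematicalPhysics.QuantumFieldTheory.Balaban1983to89.B11Thm1LevelZero (isBackground_zero_iff inUkClassB11_zero_of_plaqSmall)
open Literature.MathematicalPhysics.QuantumFieldTheory.Balaban1983to89.B11Thm1CarrierTLevelZero (inUkClassB11_mono)
open Literature.MathematicalPhysics.QuantumFieldTheory.Balaban1983to89.B11Thm1ExistsUniqueCoP7MG (VariationalThm1EUSepCoP7MG)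
open B12Eq019ActionBody (integrand)
open Summit.QuantumFields.YangMills.BalabanUVNodes.K0Beta13RadiusBlindGuarded (betaOfRecord₁₃_thm1CCMWZB_radiusBlind_of_readSet_guarded firstForm_of_chiFix29_of_lipschitz_at)
open Summit.QuantumFields.YangMills.BalabanUVNodes.K0TwoPrimeOfMembershipDomain (firstForm_of_mem_domU mem_domU_of_firstForm one_mem_domU isOpen_domU_of_slots
  iter_Uk_mem_domU Uk_eq_of_mem_domU_of_le)
open Summit.QuantumFields.YangMills.BalabanUVNodes.K0TwoPrimeOfLipschitzCollar (chiFix29OfRecord_congr_εreg interior_of_slots)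
open Summit.QuantumFields.YangMills.BalabanUVNodes.K0TopSocketOfThm1EUText (thm1Objects_of_texts)

/-! ## §1  The downward β-identity with the slots asked inside a level guard only -/

section Identity

variable (F : T4Family)

/-- ★ **DOWNWARD RADIUS BLINDNESS, SLOTS INSIDE A LEVEL GUARD.**  ✓p795400's `betaZB_eq_down_of_slots` with the four N07 slots asked only at members `(K, k)` with `G K k` and the continuity row
only at steps `k < K` with `G K (k+1)`, for a guard `G` ANTITONE in the level and EVENTUALLY TRUE in `K` at each level (e.g. `k + c ≤ F.m + K`).  Conclusion unchanged:
`β₁₃(F; ā, ε₂₉) = β₁₃(F; a₀, ε₂₉)` for `ρ ≤ a₀ ≤ ā`.  CONDITIONAL on the displayed rows; NO β estimate; nothing of Bałaban's asserted.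
[cite: Balaban1987RG1, (1.20)–(1.22) p.264, (1.21) «T^{(j+1)} ↗ Z^d», (1.1)–(1.2) p.260, p.259, (2.3) p.265, (2.9) p.266 and p.267; Balaban1985Variational, Thm 1 (6),(8)–(10) p.279, Prop. 7 p.299, Prop. 9 p.309; Balaban1985Averaging, Prop. 2 (53) p.26 (bookkeeping)] -/
theorem betaZB_eq_down_of_slots_guarded (ā δ₁₁ α₀ α₁ B α tL rL BL : ℝ) (hā : 0 < ā) (hāα₀ : ā < α₀) (hB : 0 ≤ B)
    (hδ₁₁ : 0 < δ₁₁) (hδα₁ : δ₁₁ ≤ α₁) (hBδ : B * δ₁₁ ≤ ā)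
    (hāα : ā < α) (hα3 : 143 * 256 * α ≤ 1 / 3) (hα2 : 2 * α ≤ 2 * deltaSU (Fin 2) / (8 * (F.L : ℝ)) ^ 2)
    (hα24 : 9 * (F.L : ℝ) ^ 2 * (2 * α) ≤ 1 / 24) (hαL : 157 * (9 * (F.L : ℝ) ^ 2 * (2 * α)) < ((F.L : ℝ) ^ 3)⁻¹)
    (G : ℕ → ℕ → Prop) (hmono : ∀ K k, G K (k + 1) → G K k) (hev : ∀ k, ∀ᶠ K in atTop, G K k)
    (hT1 : ∀ (K k : ℕ), G K k → ∀ ε₁ : ℝ, 0 < ε₁ → ε₁ ≤ α₁ → ∀ V : GaugeField (F.P K) k (Node00.SU 2), PlaqSmall ε₁ V →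
      (∃ U : GaugeField (F.P K) 0 (Node00.SU 2), IsBackground (avOfRecord F 2 K) {U | InUkClassB11 F 2 K k (B * ε₁) U} k V U) ∧
      (∀ ε₀ : ℝ, B * ε₁ ≤ ε₀ → ε₀ ≤ α₀ → ∀ U U' : GaugeField (F.P K) 0 (Node00.SU 2),
          IsBackground (avOfRecord F 2 K) {U | InUkClassB11 F 2 K k (B * ε₁) U} k V U →
          IsBackground (avOfRecord F 2 K) {U | InUkClassB11 F 2 K k ε₀ U} k V U' → InUkClassB11 F 2 K k ε₀ U ∧ OrbitRel k U U'))
    (hUk : ∀ (K k : ℕ), G K k → ∀ ε : ℝ, ā ≤ ε → ε ≤ α₀ → ∀ (V : GaugeField (F.P K) k (Node00.SU 2)) (δ : ℝ), 0 < δ → δ ≤ α₁ → B * δ ≤ ε → PlaqSmall δ V →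
      UkExists F 2 K k ε V ∧ InUkClassB11 F 2 K k ε (Uk F 2 K k ε V))
    (h11 : ∀ (K k : ℕ), G K k → ∀ ε : ℝ, ā ≤ ε → ε ≤ α₀ → ∀ V : GaugeField (F.P K) k (Node00.SU 2), PlaqSmall δ₁₁ V → UkExists F 2 K k ε V ∧ UniqueUkOrbit F 2 K k ε V)
    (hLip : ∀ (K k : ℕ), G K k → ∀ (V V' : GaugeField (F.P K) k (Node00.SU 2)) (t r : ℝ), 0 ≤ t → t ≤ tL → 0 < r → r ≤ rL →
      (∀ b, dist1 ((V' b)⁻¹ * V b) ≤ t) →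
      (UkExists F 2 K k ā V' ∧ ∀ U₁, IsBackground (avOfRecord F 2 K) (bgReg F 2 K k ā) k V' U₁ → U₁ ∈ bgReg F 2 K k r) →
      (UkExists F 2 K k ā V ∧ ∀ U₁, IsBackground (avOfRecord F 2 K) (bgReg F 2 K k ā) k V U₁ → U₁ ∈ bgReg F 2 K k (r + BL * t)))
    {a₀ ρ ε₂₉ : ℝ} (hle : a₀ ≤ ā) (hρa : ρ ≤ a₀)
    (hρ : 0 < ρ) (h53a : 143 * 256 * ρ ≤ 1 / 3) (h53b : 2 * ρ ≤ 2 * deltaSU (Fin 2) / (8 * (F.L : ℝ)) ^ 2)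
    (hδ : 2 * ρ ≤ δ₁₁) (hα₁ : 2 * ρ ≤ α₁) (hBρ : 2 * B * ρ ≤ ā) (hε29 : 0 ≤ ε₂₉)
    (hn1 : 1640 * (12 * (F.L : ℝ) * ε₂₉ + 18 * ā) * (F.L : ℝ) ^ 6 ≤ 1) (hn2 : 13 * (12 * (F.L : ℝ) * ε₂₉ + 18 * ā) * (F.L : ℝ) ^ 3 < deltaSU (Fin 2))
    (htL : 60 * (F.L : ℝ) ^ 4 * ε₂₉ ≤ tL) (hrL : ρ / (F.L : ℝ) ^ 2 ≤ rL) (hLρ : ρ / (F.L : ℝ) ^ 2 + BL * (60 * (F.L : ℝ) ^ 4 * ε₂₉) ≤ ρ)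
    (hT : ∀ K (g : ℕ → ℝ) k, k < K → G K (k + 1) → {V : GaugeField (F.P K) (k + 1) (Node00.SU 2) | PlaqSmall δ₁₁ V} ⊆ regSetOfRecord F 2 K k
      (integrand (chiFixed29 F 2 (numerics7OfThm1CCM F.L 0 0 0 0 ā 0) ε₂₉ K g k) (gfOfRecord F 2 K k) (g k)
        (effActionHT F 2 (TcanOfRecord F 2) (chiFixed29 F 2 (numerics7OfThm1CCM F.L 0 0 0 0 ā 0) ε₂₉) K g k))) :
    betaOfRecord₁₃ F 2 (theta13OfThm1CCMWZB F 2 0 (1 / 2) ā 0 ε₂₉ 0 0 ā 0 (fun _ _ => 0) (fun _ _ => 0)) =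
      betaOfRecord₁₃ F 2 (theta13OfThm1CCMWZB F 2 0 (1 / 2) a₀ 0 ε₂₉ 0 0 a₀ 0 (fun _ _ => 0) (fun _ _ => 0)) := by
  have hā53a : 143 * 256 * ā ≤ 1 / 3 := by nlinarith
  have hā53b : 2 * ā ≤ 2 * deltaSU (Fin 2) / (8 * (F.L : ℝ)) ^ 2 := by linarith
  have hα : 0 < α := hā.trans hāα
  -- a threshold carrier whose `ε₀` is `δ₁₁`
  obtain ⟨ν₁, hν⟩ : ∃ ν₁ : Stage7Numerics, ν₁.ε₀ = δ₁₁ :=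
    ⟨{ M₁ := 0, M₂ := 0, r := 0, p₀ := 0, A₀ := 0, logσ₀ := 0, εreg := 0, ε₀ := δ₁₁ }, rfl⟩
  have hδν : 2 * ρ ≤ ν₁.ε₀ := hν ▸ hδ
  -- the slots at the fixed radius `ā` and the guarded member, on the threshold ball of `ν₁`
  have h11ν : ∀ (K k : ℕ), G K k → ∀ V : GaugeField (F.P K) k (Node00.SU 2), PlaqSmall ν₁.ε₀ V → UkExists F 2 K k ā V ∧ UniqueUkOrbit F 2 K k ā V := by
    rw [hν]; exact fun K k hG => h11 K k hG ā le_rfl hāα₀.le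
  have hUkā : ∀ (K k : ℕ), G K k → ∀ (V : GaugeField (F.P K) k (Node00.SU 2)) (δ : ℝ), 0 < δ → δ ≤ α₁ → B * δ ≤ ā → PlaqSmall δ V →
      UkExists F 2 K k ā V ∧ InUkClassB11 F 2 K k ā (Uk F 2 K k ā V) := fun K k hG => hUk K k hG ā le_rfl hāα₀.le
  -- (I) at the door's radius from the slots at the ceiling `α₀ > ā`, at the guarded member
  have hIν : ∀ (K k : ℕ), G K k → ∀ V : GaugeField (F.P K) k (Node00.SU 2), PlaqSmall ν₁.ε₀ V → ∀ U₀ : GaugeField (F.P K) 0 (Node00.SU 2),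
      IsBackground (avOfRecord F 2 K) (closure (bgReg F 2 K k ā)) k V U₀ → U₀ ∈ bgReg F 2 K k ā := by
    rw [hν]
    exact fun K k hG V hV => interior_of_slots K k hāα₀ le_rfl hδ₁₁ hδα₁ hBδ (hT1 K k hG) (hUk K k hG α₀ hāα₀.le le_rfl) (h11 K k hG α₀ hāα₀.le le_rfl) hV
  -- the statement's carrier and the `δ₁₁`-member's carrier have the same `εreg = ā`, hence the same cutoff
  have hχ : ∀ (K k : ℕ), chiFix29OfRecord F 2 (numerics7OfThm1CCM F.L 0 0 0 0 ā 0) ε₂₉ K k =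
      chiFix29OfRecord F 2 (numerics7OfThm1CCM F.L 0 δ₁₁ 0 0 ā 0) ε₂₉ K k := fun K k => chiFix29OfRecord_congr_εreg rfl ε₂₉ K k
  -- the collar row (hS) at the guarded member from `hLip` + the single-level rider + the slots there
  have hS : ∀ K k V, k < K → G K (k + 1) →
      (UkExists F 2 K (k + 1) ā ((avOfRecord F 2 K k).avg V) ∧
        ∀ U₁, IsBackground (avOfRecord F 2 K) (bgReg F 2 K (k + 1) ā) (k + 1) ((avOfRecord F 2 K k).avg V) U₁ → U₁ ∈ bgReg F 2 K (k + 1) ρ) →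
      chiFix29OfRecord F 2 (numerics7OfThm1CCM F.L 0 0 0 0 ā 0) ε₂₉ K k V ≠ 0 →
      UkExists F 2 K k ā V ∧ ∀ U₁, IsBackground (avOfRecord F 2 K) (bgReg F 2 K k ā) k V U₁ → U₁ ∈ bgReg F 2 K k ρ := by
    intro K k V hk hG hW hz
    rw [hχ] at hz
    have hGk : G K k := hmono K k hG
    exact firstForm_of_chiFix29_of_lipschitz_at K k hk hā hāα₀.le hB hā53a hā53b hρ h53a h53b hδ hα₁ hBρ hε29 hn1 hn2 htL hrL hLρ (hT1 K k hGk)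
      (hUk K k hGk ā le_rfl hāα₀.le) (h11 K k hGk ā le_rfl hāα₀.le) (hLip K k hGk) hW hz
  -- the domain system: the membership domain in range, `univ` above `K`
  obtain ⟨Û, hÛ⟩ : ∃ Û : (K k : ℕ) → Set (GaugeField (F.P K) k (Node00.SU 2)),
      Û = fun K k => if k ≤ K then domUOfRecord F 2 ν₁ ā ρ K k else Set.univ := ⟨_, rfl⟩
  have hin : ∀ K k, k ≤ K → Û K k = domUOfRecord F 2 ν₁ ā ρ K k := fun K k hk => by rw [hÛ]; exact if_pos hk
  have hout : ∀ K k, ¬ k ≤ K → Û K k = Set.univ := fun K k hk => by rw [hÛ]; exact if_neg hk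
  have hUo : ∀ K k, G K k → IsOpen (Û K k) := by
    intro K k hG
    by_cases hk : k ≤ K
    · rw [hin K k hk]
      exact isOpen_domU_of_slots K k (hk.trans (Nat.le_add_left K F.m)) hāα hα hα3 hα2 hα24 hαL hρ h53a h53b hδν (hIν K k hG)
        fun V hV => (h11ν K k hG V hV).2
    · rw [hout K k hk]; exact isOpen_univ
  have hU1 : ∀ K k, G K k → (1 : GaugeField (F.P K) k (Node00.SU 2)) ∈ Û K k := by
    intro K k hG
    by_cases hk : k ≤ K
    · rw [hin K k hk]; exact one_mem_domU K k hā hρ h53a h53b hδν (h11ν K k hG)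
    · rw [hout K k hk]; exact Set.mem_univ _
  have hC : ∀ K (g : ℕ → ℝ) k, k < K → G K (k + 1) → Û K (k + 1) ⊆ regSetOfRecord F 2 K k
      (integrand (chiFixed29 F 2 (numerics7OfThm1CCM F.L 0 0 0 0 ā 0) ε₂₉ K g k) (gfOfRecord F 2 K k) (g k)
        (effActionHT F 2 (TcanOfRecord F 2) (chiFixed29 F 2 (numerics7OfThm1CCM F.L 0 0 0 0 ā 0) ε₂₉) K g k)) := by
    intro K g k hk hG V hV
    rw [hin K (k + 1) hk] at hV
    exact hT K g k hk hG (hν ▸ ((mem_domUOfRecord_iff ν₁ ā ρ K (k + 1) V).1 hV).1)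
  have hN : ∀ K k V, k < K → G K (k + 1) → (avOfRecord F 2 K k).avg V ∈ Û K (k + 1) →
      chiFix29OfRecord F 2 (numerics7OfThm1CCM F.L 0 0 0 0 ā 0) ε₂₉ K k V ≠ 0 → V ∈ Û K k := by
    intro K k V hk hG hV hz
    rw [hin K (k + 1) hk] at hV
    rw [hin K k (Nat.le_of_lt hk)]
    exact mem_domU_of_firstForm hρ h53a h53b hδν (h11ν K k (hmono K k hG)) (hS K k V hk hG (firstForm_of_mem_domU hV) hz)
  have hBr : ∀ K k W, k < K → G K (k + 1) → W ∈ Û K (k + 1) → Averaging.iter (avOfRecord F 2 K) k (Uk F 2 K (k + 1) ā W) ∈ Û K k := by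
    intro K k W hk hG hW
    rw [hin K (k + 1) hk] at hW
    rw [hin K k (Nat.le_of_lt hk)]
    have hGk : G K k := hmono K k hG
    exact iter_Uk_mem_domU K k hā hāα₀.le hρ h53a h53b hδν hα₁ hB hBρ (hT1 K k hGk) (hUkā K k hGk) (h11ν K k hGk) hW
  -- guarded radius blindness ā ↦ a₀ at the zero member, selector agreement DOWNWARD only
  refine betaOfRecord₁₃_thm1CCMWZB_radiusBlind_of_readSet_guarded F 2 0 (1 / 2) 0 ε₂₉ 0 0 0 ā a₀ _ _ G hmono hev Û hUo hU1 ?_ hC hN hBr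
  intro K k W hk _ hW
  rw [hin K (k + 1) hk] at hW
  exact Uk_eq_of_mem_domU_of_le hle hρa hW

end Identity

/-! ## §2  Door (κ_cof)'s `F`-clause from the one-radius comparability letter, slots inside the guard -/

section Door

variable (F : T4Family)

/-- ★★ **DOOR (κ_cof)'s `F`-CLAUSE FROM 2-COMPARABILITY AT ONE FIXED RADIUS, SLOTS INSIDE A LEVEL GUARD** — ✓p795400's `k0CompCofinalRadii_clause_of_compAtFixedRadius` with the four
N07 slots asked only at guarded members and the continuity rows only at guarded steps (guard `G` antitone in the level, eventually true in `K`).  Same radius∕threshold bookkeeping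
(`a₀ := min a ā`, `ε₂₉ := min εmax (a₀∕c)`, `ρ := c·ε₂₉`, `c := 80B_L L⁴ + 1`).  CONDITIONAL on every displayed row; NO β estimate; nothing of Bałaban's asserted.
[cite: Balaban1987RG1, Thm 3 p.264, §1 p.264, (0.20) p.256, (1.20)–(1.22) p.264, (1.1)–(1.2) p.260, (2.9) p.266 and p.267; Balaban1988Convergent, (2.6)–(2.8) pp.255–256; Balaban1985Variational, Thm 1 (6),(8)–(10) p.279, Prop. 9 p.309; Balaban1985Averaging, Prop. 2 (53) p.26 (bookkeeping)] -/
theorem k0CompCofinalRadii_clause_of_compAtFixedRadius_guarded (ā δ₁₁ α₀ α₁ B α tL rL BL εmax : ℝ) (hā : 0 < ā) (hāα₀ : ā < α₀) (hB : 0 ≤ B) (hBL : 0 ≤ BL)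
    (hδ₁₁ : 0 < δ₁₁) (hδα₁ : δ₁₁ ≤ α₁) (hBδ : B * δ₁₁ ≤ ā)
    (hāα : ā < α) (hα3 : 143 * 256 * α ≤ 1 / 3) (hα2 : 2 * α ≤ 2 * deltaSU (Fin 2) / (8 * (F.L : ℝ)) ^ 2)
    (hα24 : 9 * (F.L : ℝ) ^ 2 * (2 * α) ≤ 1 / 24) (hαL : 157 * (9 * (F.L : ℝ) ^ 2 * (2 * α)) < ((F.L : ℝ) ^ 3)⁻¹)
    (hεmax : 0 < εmax)
    (hε53a : 143 * 256 * ((80 * BL * (F.L : ℝ) ^ 4 + 1) * εmax) ≤ 1 / 3)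
    (hε53b : 2 * ((80 * BL * (F.L : ℝ) ^ 4 + 1) * εmax) ≤ 2 * deltaSU (Fin 2) / (8 * (F.L : ℝ)) ^ 2)
    (hεδ : 2 * ((80 * BL * (F.L : ℝ) ^ 4 + 1) * εmax) ≤ δ₁₁) (hεα₁ : 2 * ((80 * BL * (F.L : ℝ) ^ 4 + 1) * εmax) ≤ α₁)
    (hεB : 2 * B * ((80 * BL * (F.L : ℝ) ^ 4 + 1) * εmax) ≤ ā)
    (hεn1 : 1640 * (12 * (F.L : ℝ) * εmax + 18 * ā) * (F.L : ℝ) ^ 6 ≤ 1) (hεn2 : 13 * (12 * (F.L : ℝ) * εmax + 18 * ā) * (F.L : ℝ) ^ 3 < deltaSU (Fin 2))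
    (hεtL : 60 * (F.L : ℝ) ^ 4 * εmax ≤ tL) (hεrL : (80 * BL * (F.L : ℝ) ^ 4 + 1) * εmax / (F.L : ℝ) ^ 2 ≤ rL)
    (G : ℕ → ℕ → Prop) (hmono : ∀ K k, G K (k + 1) → G K k) (hev : ∀ k, ∀ᶠ K in atTop, G K k)
    (hT1 : ∀ (K k : ℕ), G K k → ∀ ε₁ : ℝ, 0 < ε₁ → ε₁ ≤ α₁ → ∀ V : GaugeField (F.P K) k (Node00.SU 2), PlaqSmall ε₁ V →
      (∃ U : GaugeField (F.P K) 0 (Node00.SU 2), IsBackground (avOfRecord F 2 K) {U | InUkClassB11 F 2 K k (B * ε₁) U} k V U) ∧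
      (∀ ε₀ : ℝ, B * ε₁ ≤ ε₀ → ε₀ ≤ α₀ → ∀ U U' : GaugeField (F.P K) 0 (Node00.SU 2),
          IsBackground (avOfRecord F 2 K) {U | InUkClassB11 F 2 K k (B * ε₁) U} k V U →
          IsBackground (avOfRecord F 2 K) {U | InUkClassB11 F 2 K k ε₀ U} k V U' → InUkClassB11 F 2 K k ε₀ U ∧ OrbitRel k U U'))
    (hUk : ∀ (K k : ℕ), G K k → ∀ ε : ℝ, ā ≤ ε → ε ≤ α₀ → ∀ (V : GaugeField (F.P K) k (Node00.SU 2)) (δ : ℝ), 0 < δ → δ ≤ α₁ → B * δ ≤ ε → PlaqSmall δ V →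
      UkExists F 2 K k ε V ∧ InUkClassB11 F 2 K k ε (Uk F 2 K k ε V))
    (h11 : ∀ (K k : ℕ), G K k → ∀ ε : ℝ, ā ≤ ε → ε ≤ α₀ → ∀ V : GaugeField (F.P K) k (Node00.SU 2), PlaqSmall δ₁₁ V → UkExists F 2 K k ε V ∧ UniqueUkOrbit F 2 K k ε V)
    (hLip : ∀ (K k : ℕ), G K k → ∀ (V V' : GaugeField (F.P K) k (Node00.SU 2)) (t r : ℝ), 0 ≤ t → t ≤ tL → 0 < r → r ≤ rL →
      (∀ b, dist1 ((V' b)⁻¹ * V b) ≤ t) →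
      (UkExists F 2 K k ā V' ∧ ∀ U₁, IsBackground (avOfRecord F 2 K) (bgReg F 2 K k ā) k V' U₁ → U₁ ∈ bgReg F 2 K k r) →
      (UkExists F 2 K k ā V ∧ ∀ U₁, IsBackground (avOfRecord F 2 K) (bgReg F 2 K k ā) k V U₁ → U₁ ∈ bgReg F 2 K k (r + BL * t)))
    (hcomp : ∀ ε₂₉ : ℝ, 0 < ε₂₉ → ε₂₉ ≤ εmax → ∃ γ₀ : ℝ, 0 < γ₀ ∧
      ∀ (n : ℕ) (gs : ℕ → ℝ), RGEqH n (betaOfRecord₁₃ F 2 (theta13OfThm1CCMWZB F 2 0 (1 / 2) ā 0 ε₂₉ 0 0 ā 0 (fun _ _ => 0) (fun _ _ => 0))) gs →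
        Step.InInterval γ₀ n gs → ∀ m, m < n → gs m ≤ 2 * gs (m + 1) ∧ gs (m + 1) ≤ 2 * gs m)
    (hT : ∀ ε₂₉ : ℝ, 0 < ε₂₉ → ε₂₉ ≤ εmax → ∀ K (g : ℕ → ℝ) k, k < K → G K (k + 1) →
      {V : GaugeField (F.P K) (k + 1) (Node00.SU 2) | PlaqSmall δ₁₁ V} ⊆ regSetOfRecord F 2 K k
        (integrand (chiFixed29 F 2 (numerics7OfThm1CCM F.L 0 0 0 0 ā 0) ε₂₉ K g k) (gfOfRecord F 2 K k) (g k)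
          (effActionHT F 2 (TcanOfRecord F 2) (chiFixed29 F 2 (numerics7OfThm1CCM F.L 0 0 0 0 ā 0) ε₂₉) K g k))) :
    ∀ a : ℝ, 0 < a → ∃ a₀ : ℝ, 0 < a₀ ∧ a₀ ≤ a ∧
      ∃ (γ₀ ε₂₉ : ℝ) (j : ℕ) (ε₀ B₃ B₃' a₁ : ℝ) (Efl logz : B12.RunParams → ℕ → ℝ), 0 < γ₀ ∧ 0 < ε₂₉ ∧
        ∀ (n : ℕ) (gs : ℕ → ℝ), RGEqH n (betaOfRecord₁₃ F 2 (theta13OfThm1CCMWZB F 2 j (1 / 2) a₀ ε₀ ε₂₉ B₃ B₃' a₀ a₁ Efl logz)) gs → Step.InInterval γ₀ n gs →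
          ∀ m, m < n → gs m ≤ 2 * gs (m + 1) ∧ gs (m + 1) ≤ 2 * gs m := by
  intro a ha
  have hL11 : (11 : ℝ) < (F.L : ℝ) := by exact_mod_cast F.hL11
  have hL0 : (0 : ℝ) < (F.L : ℝ) := by linarith
  have hL4 : (4 : ℝ) ≤ (F.L : ℝ) ^ 2 := by nlinarith
  obtain ⟨c, hc⟩ : ∃ c : ℝ, c = 80 * BL * (F.L : ℝ) ^ 4 + 1 := ⟨_, rfl⟩
  have hcpos : 0 < c := by rw [hc]; positivity
  obtain ⟨a₀, ha₀⟩ : ∃ a₀ : ℝ, a₀ = min a ā := ⟨_, rfl⟩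
  have ha₀pos : 0 < a₀ := by rw [ha₀]; exact lt_min ha hā
  have ha₀a : a₀ ≤ a := by rw [ha₀]; exact min_le_left _ _
  have ha₀ā : a₀ ≤ ā := by rw [ha₀]; exact min_le_right _ _
  obtain ⟨ε, hε⟩ : ∃ ε : ℝ, ε = min εmax (a₀ / c) := ⟨_, rfl⟩
  have hεpos : 0 < ε := by rw [hε]; exact lt_min hεmax (div_pos ha₀pos hcpos)
  have hεle : ε ≤ εmax := by rw [hε]; exact min_le_left _ _
  have hεa₀ : ε ≤ a₀ / c := by rw [hε]; exact min_le_right _ _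
  have hρle : c * ε ≤ c * εmax := mul_le_mul_of_nonneg_left hεle hcpos.le
  have hcε : c * εmax = (80 * BL * (F.L : ℝ) ^ 4 + 1) * εmax := by rw [hc]
  have hρa₀ : c * ε ≤ a₀ := by
    calc c * ε ≤ c * (a₀ / c) := mul_le_mul_of_nonneg_left hεa₀ hcpos.le
      _ = a₀ := mul_div_cancel₀ a₀ hcpos.ne'
  have h53a : 143 * 256 * (c * ε) ≤ 1 / 3 :=
    calc 143 * 256 * (c * ε) ≤ 143 * 256 * (c * εmax) := by gcongr
      _ ≤ 1 / 3 := by rw [hcε]; exact hε53a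
  have h53b : 2 * (c * ε) ≤ 2 * deltaSU (Fin 2) / (8 * (F.L : ℝ)) ^ 2 :=
    calc 2 * (c * ε) ≤ 2 * (c * εmax) := by gcongr
      _ ≤ 2 * deltaSU (Fin 2) / (8 * (F.L : ℝ)) ^ 2 := by rw [hcε]; exact hε53b
  have hδ : 2 * (c * ε) ≤ δ₁₁ :=
    calc 2 * (c * ε) ≤ 2 * (c * εmax) := by gcongr
      _ ≤ δ₁₁ := by rw [hcε]; exact hεδ
  have hα₁ : 2 * (c * ε) ≤ α₁ :=
    calc 2 * (c * ε) ≤ 2 * (c * εmax) := by gcongr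
      _ ≤ α₁ := by rw [hcε]; exact hεα₁
  have hBρ : 2 * B * (c * ε) ≤ ā :=
    calc 2 * B * (c * ε) ≤ 2 * B * (c * εmax) := mul_le_mul_of_nonneg_left hρle (by positivity)
      _ ≤ ā := by rw [hcε]; exact hεB
  have hn1 : 1640 * (12 * (F.L : ℝ) * ε + 18 * ā) * (F.L : ℝ) ^ 6 ≤ 1 := by
    have h : 1640 * (12 * (F.L : ℝ) * ε + 18 * ā) * (F.L : ℝ) ^ 6 ≤ 1640 * (12 * (F.L : ℝ) * εmax + 18 * ā) * (F.L : ℝ) ^ 6 := by gcongr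
    exact h.trans hεn1
  have hn2 : 13 * (12 * (F.L : ℝ) * ε + 18 * ā) * (F.L : ℝ) ^ 3 < deltaSU (Fin 2) := by
    have h : 13 * (12 * (F.L : ℝ) * ε + 18 * ā) * (F.L : ℝ) ^ 3 ≤ 13 * (12 * (F.L : ℝ) * εmax + 18 * ā) * (F.L : ℝ) ^ 3 := by gcongr
    exact h.trans_lt hεn2
  have htL : 60 * (F.L : ℝ) ^ 4 * ε ≤ tL :=
    calc 60 * (F.L : ℝ) ^ 4 * ε ≤ 60 * (F.L : ℝ) ^ 4 * εmax := by gcongr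
      _ ≤ tL := hεtL
  have hrL : c * ε / (F.L : ℝ) ^ 2 ≤ rL :=
    calc c * ε / (F.L : ℝ) ^ 2 ≤ c * εmax / (F.L : ℝ) ^ 2 := by gcongr
      _ ≤ rL := by rw [hcε]; exact hεrL
  have hLρ : c * ε / (F.L : ℝ) ^ 2 + BL * (60 * (F.L : ℝ) ^ 4 * ε) ≤ c * ε := by
    have h1 : c * ε / (F.L : ℝ) ^ 2 ≤ c * ε / 4 := div_le_div_of_nonneg_left (by positivity) (by norm_num) hL4
    have h2 : BL * (60 * (F.L : ℝ) ^ 4 * ε) = 60 * (BL * (F.L : ℝ) ^ 4 * ε) := by ring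
    have h3 : c * ε = 80 * (BL * (F.L : ℝ) ^ 4 * ε) + ε := by rw [hc]; ring
    have h4 : 0 ≤ BL * (F.L : ℝ) ^ 4 * ε := by positivity
    rw [h2]
    linarith
  have heq := betaZB_eq_down_of_slots_guarded F ā δ₁₁ α₀ α₁ B α tL rL BL hā hāα₀ hB hδ₁₁ hδα₁ hBδ hāα hα3 hα2 hα24 hαL G hmono hev hT1 hUk h11 hLip
    ha₀ā hρa₀ (mul_pos hcpos hεpos) h53a h53b hδ hα₁ hBρ hεpos.le hn1 hn2 htL hrL hLρ (hT ε hεpos hεle)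
  obtain ⟨γ₀, hγ₀, hC⟩ := hcomp ε hεpos hεle
  refine ⟨a₀, ha₀pos, ha₀a, γ₀, ε, 0, 0, 0, 0, 0, fun _ _ => 0, fun _ _ => 0, hγ₀, hεpos, ?_⟩
  rw [← heq]
  exact hC

end Door

/-! ## §3  `hT1` inside the S1c-type guard from the (8)-text and the EU-text; the door with `hT1` discharged -/

section Texts

variable (F : T4Family) {N : ℕ} [NeZero N]

/-- ★★ **THE SLOT `hT1` INSIDE THE LEVEL GUARD `k + max c₀ c₁ ≤ F.m + K` FROM THE TWO [15] TEXTS** — constant `B := B₃ ≥ 7`, ceilings `(a₀, min a₁ (a₀∕B₃))`: at levels `k ≥ 1` g20's (T1) socket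
`thm1Objects_of_texts` (the clause's extra premise `B₃ε₁ ≤ a₀` is the ceiling `ε₁ ≤ a₀∕B₃`); at level `0` the datum itself is the unique minimiser (dag-n21-c's argument, `Ū^0 = id`, the
plaquette bound `InUkClassB11 … 0 (7ε₁)` moved to `B₃ε₁` by monotonicity).  CONDITIONAL on both texts; nothing of Bałaban's asserted.
[cite: Balaban1985Variational, Thm 1 (6),(8)–(10) pp.278–279; Balaban1987RG1, (1.1)–(1.2) p.260, (0.21) p.256; Balaban1988Convergent, (2.12) p.256] -/
theorem hT1_guarded_of_texts {c c₀ c₁ : ℕ} {B₃ a₀ a₁ : ℝ} (hB₃ : 7 ≤ B₃)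
    (h15 : VariationalThm1RegSepCoP7MGB F N
      (fun ν M g K k _s => c ≤ ν.M₁ ∧ k + c₀ ≤ F.m + K ∧ F.L ^ c₁ ∣ M ∧
        ∀ i, 1 ≤ i → i ≤ k → dCubeSide (F.P K).L M (RkOfRecord (F.P K).L ν.r (g i)) i ∣ (F.P K).sitesPerDir 0) (lamDatum F) (dataSmall7LamTopOf F N) B₃ a₀ a₁)
    (hEU : VariationalThm1EUSepCoP7MG F N
      (fun ν M g K k _s => c ≤ ν.M₁ ∧ k + c₀ ≤ F.m + K ∧ F.L ^ c₁ ∣ M ∧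
        ∀ i, 1 ≤ i → i ≤ k → dCubeSide (F.P K).L M (RkOfRecord (F.P K).L ν.r (g i)) i ∣ (F.P K).sitesPerDir 0) B₃ a₀ a₁) :
    ∀ (K k : ℕ), k + max c₀ c₁ ≤ F.m + K → ∀ ε₁ : ℝ, 0 < ε₁ → ε₁ ≤ min a₁ (a₀ / B₃) → ∀ V : GaugeField (F.P K) k (SU N), PlaqSmall ε₁ V →
      (∃ U : GaugeField (F.P K) 0 (SU N), IsBackground (avOfRecord F N K) {U | InUkClassB11 F N K k (B₃ * ε₁) U} k V U) ∧
      (∀ ε₀ : ℝ, B₃ * ε₁ ≤ ε₀ → ε₀ ≤ a₀ → ∀ U U' : GaugeField (F.P K) 0 (SU N),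
          IsBackground (avOfRecord F N K) {U | InUkClassB11 F N K k (B₃ * ε₁) U} k V U →
          IsBackground (avOfRecord F N K) {U | InUkClassB11 F N K k ε₀ U} k V U' → InUkClassB11 F N K k ε₀ U ∧ OrbitRel k U U') := by
  intro K k hG ε₁ hε₁ hε₁le V hV
  have hB₃0 : 0 ≤ B₃ := by linarith
  have hB₃pos : 0 < B₃ := by linarith
  have hε₁a : ε₁ ≤ a₁ := hε₁le.trans (min_le_left _ _)
  have hBa : B₃ * ε₁ ≤ a₀ := by
    have h := hε₁le.trans (min_le_right _ _)
    calc B₃ * ε₁ ≤ B₃ * (a₀ / B₃) := mul_le_mul_of_nonneg_left h hB₃0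
      _ = a₀ := mul_div_cancel₀ a₀ hB₃pos.ne'
  rcases Nat.eq_zero_or_pos k with rfl | hk
  · -- level `0`: the datum itself
    have hV7 : InUkClassB11 F N K 0 (B₃ * ε₁) V :=
      inUkClassB11_mono (mul_le_mul_of_nonneg_right hB₃ hε₁.le) (inUkClassB11_zero_of_plaqSmall F N K hε₁ hV)
    refine ⟨⟨V, (isBackground_zero_iff _ _ V V).2 ⟨rfl, hV7⟩⟩, ?_⟩
    intro ε₀ hlo _ U U' hU hU'
    obtain ⟨hUV, -⟩ := (isBackground_zero_iff _ _ V U).1 hU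
    obtain ⟨hU'V, -⟩ := (isBackground_zero_iff _ _ V U').1 hU'
    subst hUV hU'V
    exact ⟨inUkClassB11_mono hlo hV7, OrbitRel.refl 0 _⟩
  · -- levels `k ≥ 1`: g20's (T1) socket
    have hc₀ : k + c₀ ≤ F.m + K := le_trans (Nat.add_le_add_left (le_max_left c₀ c₁) k) hG
    have hc₁ : k + c₁ ≤ F.m + K := le_trans (Nat.add_le_add_left (le_max_right c₀ c₁) k) hG
    exact thm1Objects_of_texts F N hB₃0 h15 hEU hk hc₀ hc₁ ε₁ hε₁ hε₁a hBa V hV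

/-- ★★★ **DOOR (κ_cof)'s `F`-CLAUSE FROM THE TWO TEXTS + `hUk ∕ h11 ∕ hLip` INSIDE THE GUARD + THE ONE-RADIUS COMPARABILITY LETTER** — §2 at the guard `G K k := k + max c₀ c₁ ≤ F.m + K`
(antitone; eventually true in `K`), constant `B := B₃`, ceilings `α₀ := a₀` and `α₁ := min a₁ (a₀∕B₃)` read off the texts' letters, with `hT1` DISCHARGED by `hT1_guarded_of_texts`.  At `N = 2`
the (8)-text at the S1c witness's letters is dag-n07-e's theorem (g20 file 5 §7 `exists_plaqSmall_of_isBackground_inUkClassB11_SU2`'s source), so the EU-text is the only Theorem-1 sentence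
left on this line; `hUk ∕ h11` (PLAQUETTE-class rows, D-defB-1) and `hLip` remain.  CONDITIONAL on every displayed row; NO β estimate; nothing of Bałaban's asserted; K0⁷ NOT closed.
[cite: Balaban1985Variational, Thm 1 (6),(8)–(10) pp.278–279, Prop. 8 p.304, Prop. 9 p.309; Balaban1987RG1, Thm 3 p.264, §1 p.264, (0.20) p.256, (1.20)–(1.22) p.264, (1.1)–(1.2) p.260, (2.9) p.266 and p.267; Balaban1988Convergent, (2.6)–(2.8) pp.255–256, (2.12) p.256; Balaban1985Averaging, Prop. 2 (53) p.26 (bookkeeping)] -/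
theorem k0CompCofinalRadii_clause_of_texts_of_compAtFixedRadius {c c₀ c₁ : ℕ} {B₃ a₀ a₁ : ℝ} (hB₃ : 7 ≤ B₃)
    (h15 : VariationalThm1RegSepCoP7MGB F 2
      (fun ν M g K k _s => c ≤ ν.M₁ ∧ k + c₀ ≤ F.m + K ∧ F.L ^ c₁ ∣ M ∧
        ∀ i, 1 ≤ i → i ≤ k → dCubeSide (F.P K).L M (RkOfRecord (F.P K).L ν.r (g i)) i ∣ (F.P K).sitesPerDir 0) (lamDatum F) (dataSmall7LamTopOf F 2) B₃ a₀ a₁)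
    (hEU : VariationalThm1EUSepCoP7MG F 2
      (fun ν M g K k _s => c ≤ ν.M₁ ∧ k + c₀ ≤ F.m + K ∧ F.L ^ c₁ ∣ M ∧
        ∀ i, 1 ≤ i → i ≤ k → dCubeSide (F.P K).L M (RkOfRecord (F.P K).L ν.r (g i)) i ∣ (F.P K).sitesPerDir 0) B₃ a₀ a₁)
    (ā δ₁₁ α tL rL BL εmax : ℝ) (hā : 0 < ā) (hāα₀ : ā < a₀) (hBL : 0 ≤ BL)
    (hδ₁₁ : 0 < δ₁₁) (hδα₁ : δ₁₁ ≤ min a₁ (a₀ / B₃)) (hBδ : B₃ * δ₁₁ ≤ ā)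
    (hāα : ā < α) (hα3 : 143 * 256 * α ≤ 1 / 3) (hα2 : 2 * α ≤ 2 * deltaSU (Fin 2) / (8 * (F.L : ℝ)) ^ 2)
    (hα24 : 9 * (F.L : ℝ) ^ 2 * (2 * α) ≤ 1 / 24) (hαL : 157 * (9 * (F.L : ℝ) ^ 2 * (2 * α)) < ((F.L : ℝ) ^ 3)⁻¹)
    (hεmax : 0 < εmax)
    (hε53a : 143 * 256 * ((80 * BL * (F.L : ℝ) ^ 4 + 1) * εmax) ≤ 1 / 3)
    (hε53b : 2 * ((80 * BL * (F.L : ℝ) ^ 4 + 1) * εmax) ≤ 2 * deltaSU (Fin 2) / (8 * (F.L : ℝ)) ^ 2)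
    (hεδ : 2 * ((80 * BL * (F.L : ℝ) ^ 4 + 1) * εmax) ≤ δ₁₁) (hεα₁ : 2 * ((80 * BL * (F.L : ℝ) ^ 4 + 1) * εmax) ≤ min a₁ (a₀ / B₃))
    (hεB : 2 * B₃ * ((80 * BL * (F.L : ℝ) ^ 4 + 1) * εmax) ≤ ā)
    (hεn1 : 1640 * (12 * (F.L : ℝ) * εmax + 18 * ā) * (F.L : ℝ) ^ 6 ≤ 1) (hεn2 : 13 * (12 * (F.L : ℝ) * εmax + 18 * ā) * (F.L : ℝ) ^ 3 < deltaSU (Fin 2))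
    (hεtL : 60 * (F.L : ℝ) ^ 4 * εmax ≤ tL) (hεrL : (80 * BL * (F.L : ℝ) ^ 4 + 1) * εmax / (F.L : ℝ) ^ 2 ≤ rL)
    (hUk : ∀ (K k : ℕ), k + max c₀ c₁ ≤ F.m + K → ∀ ε : ℝ, ā ≤ ε → ε ≤ a₀ → ∀ (V : GaugeField (F.P K) k (Node00.SU 2)) (δ : ℝ), 0 < δ → δ ≤ min a₁ (a₀ / B₃) → B₃ * δ ≤ ε →
      PlaqSmall δ V → UkExists F 2 K k ε V ∧ InUkClassB11 F 2 K k ε (Uk F 2 K k ε V))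
    (h11 : ∀ (K k : ℕ), k + max c₀ c₁ ≤ F.m + K → ∀ ε : ℝ, ā ≤ ε → ε ≤ a₀ → ∀ V : GaugeField (F.P K) k (Node00.SU 2), PlaqSmall δ₁₁ V →
      UkExists F 2 K k ε V ∧ UniqueUkOrbit F 2 K k ε V)
    (hLip : ∀ (K k : ℕ), k + max c₀ c₁ ≤ F.m + K → ∀ (V V' : GaugeField (F.P K) k (Node00.SU 2)) (t r : ℝ), 0 ≤ t → t ≤ tL → 0 < r → r ≤ rL →
      (∀ b, dist1 ((V' b)⁻¹ * V b) ≤ t) →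
      (UkExists F 2 K k ā V' ∧ ∀ U₁, IsBackground (avOfRecord F 2 K) (bgReg F 2 K k ā) k V' U₁ → U₁ ∈ bgReg F 2 K k r) →
      (UkExists F 2 K k ā V ∧ ∀ U₁, IsBackground (avOfRecord F 2 K) (bgReg F 2 K k ā) k V U₁ → U₁ ∈ bgReg F 2 K k (r + BL * t)))
    (hcomp : ∀ ε₂₉ : ℝ, 0 < ε₂₉ → ε₂₉ ≤ εmax → ∃ γ₀ : ℝ, 0 < γ₀ ∧
      ∀ (n : ℕ) (gs : ℕ → ℝ), RGEqH n (betaOfRecord₁₃ F 2 (theta13OfThm1CCMWZB F 2 0 (1 / 2) ā 0 ε₂₉ 0 0 ā 0 (fun _ _ => 0) (fun _ _ => 0))) gs →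
        Step.InInterval γ₀ n gs → ∀ m, m < n → gs m ≤ 2 * gs (m + 1) ∧ gs (m + 1) ≤ 2 * gs m)
    (hT : ∀ ε₂₉ : ℝ, 0 < ε₂₉ → ε₂₉ ≤ εmax → ∀ K (g : ℕ → ℝ) k, k < K → k + 1 + max c₀ c₁ ≤ F.m + K →
      {V : GaugeField (F.P K) (k + 1) (Node00.SU 2) | PlaqSmall δ₁₁ V} ⊆ regSetOfRecord F 2 K k
        (integrand (chiFixed29 F 2 (numerics7OfThm1CCM F.L 0 0 0 0 ā 0) ε₂₉ K g k) (gfOfRecord F 2 K k) (g k)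
          (effActionHT F 2 (TcanOfRecord F 2) (chiFixed29 F 2 (numerics7OfThm1CCM F.L 0 0 0 0 ā 0) ε₂₉) K g k))) :
    ∀ a : ℝ, 0 < a → ∃ a' : ℝ, 0 < a' ∧ a' ≤ a ∧
      ∃ (γ₀ ε₂₉ : ℝ) (j : ℕ) (ε₀ B₃'' B₃' a₁' : ℝ) (Efl logz : B12.RunParams → ℕ → ℝ), 0 < γ₀ ∧ 0 < ε₂₉ ∧
        ∀ (n : ℕ) (gs : ℕ → ℝ), RGEqH n (betaOfRecord₁₃ F 2 (theta13OfThm1CCMWZB F 2 j (1 / 2) a' ε₀ ε₂₉ B₃'' B₃' a' a₁' Efl logz)) gs → Step.InInterval γ₀ n gs →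
          ∀ m, m < n → gs m ≤ 2 * gs (m + 1) ∧ gs (m + 1) ≤ 2 * gs m := by
  have hB₃0 : 0 ≤ B₃ := by linarith
  exact k0CompCofinalRadii_clause_of_compAtFixedRadius_guarded F ā δ₁₁ a₀ (min a₁ (a₀ / B₃)) B₃ α tL rL BL εmax hā hāα₀ hB₃0 hBL hδ₁₁ hδα₁ hBδ hāα hα3 hα2 hα24 hαL
    hεmax hε53a hε53b hεδ hεα₁ hεB hεn1 hεn2 hεtL hεrL (fun K k => k + max c₀ c₁ ≤ F.m + K) (fun K k (h : k + 1 + max c₀ c₁ ≤ F.m + K) => show k + max c₀ c₁ ≤ F.m + K by omega)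
    (fun k => (eventually_ge_atTop (k + max c₀ c₁)).mono fun K hK => hK.trans (Nat.le_add_left K F.m))
    (hT1_guarded_of_texts F hB₃ h15 hEU) hUk h11 hLip hcomp hT

end Texts

end Summit.QuantumFields.YangMills.BalabanUVNodes.K0CompCofinalRadiiOfFixedRadiusGuarded
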